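import Summits.BirchSwinnertonDyer.BirchSwinnertonDyer.Theorems.SchneiderFreeAdditiveX3AnomalousIndexInputsOfPT
import Summits.BirchSwinnertonDyer.BirchSwinnertonDyer.Theorems.SchneiderFreeAdditiveX3AnomalousTwistLambdaLEOffP
import HarnessLib

/-!
# Route `SchneiderFreeAdditiveX3` (K1 door): the `p = 3` ANOMALOUS column, part 2 — Keller–Yin's anomalous λ-inequality (arXiv:2402.12781
# Thm. 1.4.1 (iii), ≤ half) for the anomalous twin `W = C • V^{(−3)}` of the door, at x1's `Sf` and at the `3`-free `Sf`, RE-TYPED GREENBERG-FREE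

Cell `bsd-schneider-ideate`, seat `bsd-schneider-door-c5` (prover, generation 40; assembly layer; `--supports` 19177).  PARTITION: board row
B6 ∩ X3 ∩ sst-twist, `r = 1`, (G-ord, `e = 2`) half at `p = 3`, ANOMALOUS twist (1 725 of 2 411 pairs; class-wide) of `Rank1Residual.partition` —
ASSEMBLY; types-the-object-of nothing new; RE-KEYS generation 31's `AnomalousTwistLambdaLE` / `AnomalousTwistLambdaLEOffP` off Greenberg's papers, on
F40a; closes none of B6's cells (BSD NOT advanced).  bears_on: K1-door (19177 r3).  Proofs token-identical to generation 31 with the binder block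
`(h263 h41 h42 h5A h32)` replaced by `hPT` = Milne ADT I Thm. 4.10 (a) at finite `S` over totally complex fields and the index-road input package taken
from F40a (Greenberg 2016 Prop. 2.6.3 (c) at totally complex `K` from `hPT` by cell `bsd-eis`'s road «SUR-Λ»; Greenberg 2006 and Tate's Euler
characteristic at totally complex fields by tree theorems).
HONEST FRAMING: compositions of tree theorems, CONDITIONAL BY NAME on the displayed statements; no definition, no named fact, no `sorry`; nothing analytic;
nothing is closed; BSD proved for no curve; «closes rung: none».  References: [KellerYin2024] Thm. 1.4.1, Prop. 1.3.2, §1.4; [MilneADT2006] I Thm. 4.10 (a);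
[Greenberg2016Selmer] Prop. 2.6.3 (c); [Greenberg2006] Props. 3.2, 4.1, 4.2, §5 A; this seat (gen 31) p715xxx; F40a.
-/

set_option autoImplicit false
set_option linter.dupNamespace false -- the route's Theorems namespace repeats the summit name by design (D-0017 nested layout)

noncomputable section

open scoped Classical

open PowerSeries WeierstrassCurve NumberField IsDedekindDomain Field
  Literature.NumberTheory.GaloisRepresentations Literature.NumberTheory.EllipticCurves.GreenbergVatsal2000
  Literature.NumberTheory.EllipticCurves Literature.NumberTheory.EllipticCurves.Rank1Residual
  Literature.NumberTheory.EllipticCurves.Castella2018 Literature.NumberTheory.EllipticCurves.GreenbergSelmer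
  Literature.NumberTheory.QuadraticFields Literature.NumberTheory.EllipticCurves.KellerYin2024
  Literature.NumberTheory.EllipticCurves.IwasawaAlgebra Literature.NumberTheory.IwasawaTheory
  Literature.NumberTheory.IwasawaTheory.Greenberg2016 Literature.NumberTheory.IwasawaTheory.Greenberg2006
  Literature.NumberTheory.GaloisCohomology
  Summit.BirchSwinnertonDyer.Rank1Residual.X2.ResidualDevissageModules
  Summit.BirchSwinnertonDyer.BirchSwinnertonDyer.Theorems
  Summit.BirchSwinnertonDyer.BirchSwinnertonDyer.Theorems.SplitMultSfTransfer
  Summit.BirchSwinnertonDyer.BirchSwinnertonDyer.Theorems.SchneiderFreeAdditiveX3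

namespace Summit.BirchSwinnertonDyer.BirchSwinnertonDyer.Theorems.SchneiderFreeAdditiveX3.AnomalousTwistLambdaLEOfPT

/-- **Keller–Yin 2402.12781 Thm. 1.4.1 (iii) (≤ half) FOR THE ANOMALOUS TWIN of the K1 door at `p = 3`, at x1's `Sf`, Greenberg-free** — generation 31's
`AnomalousTwistLambdaLE.lambdaInvariant_add_le_of_anomalousTwist` (the V21 index road: `λ(𝔛_{θsub}) + λ(𝔛_{θquot}) + … ≤ λ(X_ac^{Sf}(W_K)) + …` for
`W = C • V^{(−3)}`, `V` good ordinary at `3` with `a₃(V) ≡ 1 (mod 3)`) with the input package from F40a's `AnomalousTwistIndexInputsOfPT.indexInputs_anomalousTwist`;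
every other step (x1's `IndexPlumbingLambdaLE`, reduction-free) token-identical.  Inputs displayed: Milne ADT I Thm. 4.10 (a) (`hPT`) and `cd_3(G_{K,Σ}) ≤ 2` (`hCD2`).
[cite: KellerYin2024, Thm. 1.4.1 (iii), Prop. 1.3.2, §1.4 (arXiv:2402.12781v2)] [cite: MilneADT2006, I Thm. 4.10 (a)] [cite: Greenberg2016Selmer, Prop. 2.6.3 (c) (its consumed instance)] -/
theorem lambdaInvariant_add_le_of_anomalousTwist {V : WeierstrassCurve ℚ} [V.IsElliptic] [V.IsGloballyMinimal]
    (hPT : ∀ (L : Type) [Field L] [NumberField L] [IsTotallyComplex L] (S : Set (HeightOneSpectrum (𝓞 L))),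
      S.Finite → Literature.NumberTheory.GaloisCohomology.poitouTate_shaRestricted_tateDual_natural_at L S)
    (W : WeierstrassCurve ℚ) [W.IsElliptic] [W.IsGloballyMinimal] (p : ℕ) [Fact p.Prime]
    (hp3 : p = 3) (hV : GoodOrd V p) (ha : (p : ℤ) ∣ V.frobeniusTrace p - 1)
    (C : VariableChange ℚ) (hC : C • V.quadraticTwist ((-1 : ℚ) ^ (p / 2) * p) = W)
    (K : Type) [Field K] [NumberField K] (hK : IsImaginaryQuadratic K)
    (hCD2 : groupCdLE_two_galoisGroupUnramifiedOutside K)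
    (hH : SatisfiesHeegnerHypothesis (W.conductorNorm ℤ) K)
    (htor : ∀ Q : (W.baseChange K).toAffine.Point, p • Q = 0 → Q = 0)
    (ι : K →+* ℚ_[p]) (v vbar : HeightOneSpectrum (𝓞 K))
    (hv : ∀ x : 𝓞 K, x ∈ v.asIdeal ↔ ‖ι (x : K)‖ < 1)
    (hvbar : ((p : ℕ) : 𝓞 K) ∈ vbar.asIdeal) (hne : vbar ≠ v)
    (κ : ZpExtension K p) (hκ : κ.IsAnticyclotomic)
    (γ : absoluteGaloisGroup K) [Fact (κ.IsTopGenerator γ)]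
    (θsub θquot : FramedGaloisRep K (padicCoeffIntegers (∅ : Set (PadicAlgCl p))) 1)
    (hpair : IsResidualPairOver (W.baseChange K) p θsub θquot)
    (hram : ∃ τ ∈ decomp vbar, unitChar θsub τ ≠ 1)
    (hfinED : Finite {x : ↥((W.baseChange K).geomPrimaryTorsion p) // ∀ g : ↥(κ.kerSubgroup ⊓ decomp vbar), g • x = x})
    (Sf : Finset (HeightOneSpectrum (𝓞 K)))
    (hSf : ∀ w : HeightOneSpectrum (𝓞 K), w ∈ Sf ↔ ((W.conductorNorm ℤ : ℤ) : 𝓞 K) ∈ w.asIdeal)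
    (DSsub : DatumDualData κ γ (charModule ∅ θsub)
        (AcSelmer.bdpData (charModule ∅ θsub) p vbar) (↑Sf : Set (HeightOneSpectrum (𝓞 K))))
    (DSquot : DatumDualData κ γ (charModule ∅ θquot)
        (AcSelmer.bdpData (charModule ∅ θquot) p vbar) (↑Sf : Set (HeightOneSpectrum (𝓞 K))))
    (hfgS : Module.Finite (IwasawaAlgebra p) (AcSelmer.XAc (W.baseChange K) p κ vbar (↑Sf : Set (HeightOneSpectrum (𝓞 K))) γ))
    (htorS : Module.IsTorsion (IwasawaAlgebra p) (AcSelmer.XAc (W.baseChange K) p κ vbar (↑Sf : Set (HeightOneSpectrum (𝓞 K))) γ))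
    (hμS : muInvariant p (AcSelmer.XAc (W.baseChange K) p κ vbar (↑Sf : Set (HeightOneSpectrum (𝓞 K))) γ) = 0)
    (hSsub : ∀ D : DatumDualData κ γ (charModule ∅ θsub)
        (AcSelmer.bdpData (charModule ∅ θsub) p vbar) (↑Sf : Set (HeightOneSpectrum (𝓞 K))),
      Module.Finite (IwasawaAlgebra p) D.X ∧ Module.IsTorsion (IwasawaAlgebra p) D.X ∧ muInvariant p D.X = 0)
    (hSquot : ∀ D : DatumDualData κ γ (charModule ∅ θquot)
        (AcSelmer.bdpData (charModule ∅ θquot) p vbar) (↑Sf : Set (HeightOneSpectrum (𝓞 K))),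
      Module.Finite (IwasawaAlgebra p) D.X ∧ Module.IsTorsion (IwasawaAlgebra p) D.X ∧ muInvariant p D.X = 0) :
    lambdaInvariant p DSsub.X + lambdaInvariant p DSquot.X ≤
      lambdaInvariant p (AcSelmer.XAc (W.baseChange K) p κ vbar (↑Sf : Set (HeightOneSpectrum (𝓞 K))) γ) +
        (if ∀ σ : absoluteGaloisGroup K, θquot σ = 1 then 1 else 0) := by
  have hp : 2 < p := by omega
  have hpvK : ((p : ℕ) : 𝓞 K) ∈ v.asIdeal := IndexPlumbingNrVsStrict.natCast_mem_asIdeal_of_forall_norm_iff hv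
  -- the ∃-package of inputs for the anomalous twist
  obtain ⟨c, τ, Φ, j₁, j₃, hj₁, hj₃, hτ, hdist, hreps₁, hreps₂, hreps₃, hj₁inj, hj₃inj, hr₁, hr₃, hr₂, hd₂, hUi, hU₁, hU₂,
    hU₃, hsur₁, hsur₂, hsur₃, hprim₁, hprim₂, hprim₃, hfin₁, hfin₂, hfin₃, hinv₁, hinv₂, hinv₃, hN₂, hfinq, hε, hN₁D,
    htrivD, hfinQ, hN₃, hinvD₁, hinvD₃, hH2⟩ :=
    AnomalousTwistIndexInputsOfPT.indexInputs_anomalousTwist hPT W p hp hp3 hV ha C hC K hK hCD2 hH htor ι v vbar hv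
      hvbar hne κ hκ γ θsub θquot hpair hram hfinED Sf hSf hfgS htorS hμS hSsub hSquot
  haveI := hfin₁; haveI := hfin₂; haveI := hfin₃; haveI := hfinq; haveI := hfinQ
  haveI hEK : (W.baseChange K).IsElliptic := inferInstanceAs (W.map (algebraMap ℚ K)).IsElliptic
  have hcN₂ : ∀ b : ↥((W.baseChange K).geomTorsion (p : ℤ)), Continuous fun σ : absoluteGaloisGroup K ↦ σ • b :=
    fun b ↦ continuous_of_injective_comp (G := absoluteGaloisGroup K) Subtype.val_injective
      ((W.baseChange K).continuous_smul_geomPoints (b : geomPoints (W.baseChange K)))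
  -- DIV ×3 and LRS: `cd_p(ker κ ⊓ D_v̄) ≤ 1` (x1-p1-w4 gen 3, `AnticyclotomicLocalCdOne`)
  have hneD : ∃ τ ∈ decomp (K := K) vbar, κ τ ≠ 1 :=
    AnticyclotomicLocalCdOne.exists_mem_decomp_apply_ne_one_of_isAnticyclotomic κ vbar hK hp.ne' hκ hvbar
  have hdiv₁ : ∀ y : subgroupH1 (κ.kerSubgroup ⊓ decomp vbar) (charModule ∅ θsub), ∃ y', p • y' = y := fun y ↦ by
    obtain ⟨y', hy'⟩ := AnticyclotomicLocalCdOne.exists_eq_nsmul_subgroupH1_inf_decomp κ vbar hneD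
      (CharResidualSelmerCount.continuous_smul_charModule θsub) (CharResidualSelmerCount.charModule_divisible θsub) y
    exact ⟨y', hy'.symm⟩
  have hdiv₂ : ∀ y : subgroupH1 (κ.kerSubgroup ⊓ decomp vbar) ↥((W.baseChange K).geomPrimaryTorsion p),
      ∃ y', p • y' = y := fun y ↦ by
    obtain ⟨y', hy'⟩ := AnticyclotomicLocalCdOne.exists_eq_nsmul_subgroupH1_inf_decomp κ vbar hneD
      ((W.baseChange K).continuous_smul_geomPrimaryTorsion p) hd₂ y
    exact ⟨y', hy'.symm⟩
  have hdiv₃ : ∀ y : subgroupH1 (κ.kerSubgroup ⊓ decomp vbar) (charModule ∅ θquot), ∃ y', p • y' = y := fun y ↦ by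
    obtain ⟨y', hy'⟩ := AnticyclotomicLocalCdOne.exists_eq_nsmul_subgroupH1_inf_decomp κ vbar hneD
      (CharResidualSelmerCount.continuous_smul_charModule θquot) (CharResidualSelmerCount.charModule_divisible θquot) y
    exact ⟨y', hy'.symm⟩
  have hpQ : ∀ Q : ↥((W.baseChange K).geomTorsion (p : ℤ)), p • Q = 0 := fun Q ↦ by
    apply Subtype.ext
    have h := (mem_geomTorsion_iff (W.baseChange K) (p : ℤ) (Q : geomPoints (W.baseChange K))).mp Q.2
    rw [AddSubmonoidClass.coe_nsmul, ← natCast_zsmul, h]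
    rfl
  have hlrs := AnticyclotomicLocalCdOne.resH1Hom_id_surjective_inf_decomp κ vbar hneD
    (fun a ↦ Φ.continuous_smul_sub hcN₂ a) hcN₂ (fun a ↦ Φ.continuous_smul_quot hcN₂ a)
    (fun n ↦ ⟨1, Φ.incl_injective (by rw [map_nsmul, map_zero, pow_one]; exact hpQ _)⟩)
    Φ.incl Φ.incl_smul Φ.incl_injective Φ.proj Φ.proj_smul Φ.proj_incl
    (fun b hb ↦ Φ.mem_range_incl_of_proj_eq_zero b hb) Φ.proj_surjective
  -- FIN: `W(K_{∞,v̄})[3^∞]` finite — carried (the door's closed crux r5 `LocalTowerTorsionFiniteX3`)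
  haveI := hfinED
  -- the MID-LEVEL identity (LEAD x1-p1 g4's composition, fed the package)
  have hmid := ResidualIndexAssembly.zpCorank_datumStrictSelmer_add_eq κ.kerSubgroup p
    (↑Sf : Set (HeightOneSpectrum (𝓞 K))) vbar hvbar Φ.incl Φ.proj Φ.incl_smul Φ.proj_smul Φ.incl_injective
    Φ.proj_surjective (fun b hb ↦ Φ.mem_range_incl_of_proj_eq_zero b hb) Φ.proj_incl j₁
    (AddSubgroup.inclusion (geomTorsion_le_geomPrimaryTorsion (W.baseChange K) p)) j₃ hj₁ (fun _ _ ↦ rfl) hj₃ hj₁inj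
    (AddSubgroup.inclusion_injective _) hj₃inj hr₁ hr₂ hr₃ (CharResidualSelmerCount.charModule_divisible θsub) hd₂
    (CharResidualSelmerCount.charModule_divisible θquot) (fun a ↦ Φ.continuous_smul_sub hcN₂ a) hcN₂
    (fun a ↦ Φ.continuous_smul_quot hcN₂ a) (CharResidualSelmerCount.continuous_smul_charModule θsub)
    ((W.baseChange K).continuous_smul_geomPrimaryTorsion p) (CharResidualSelmerCount.continuous_smul_charModule θquot)
    hUi hU₁ hU₂ hU₃ c τ hreps₁ hreps₂ hreps₃ hsur₁ hsur₂ hsur₃ hdiv₁ hdiv₂ hdiv₃ hlrs hprim₁ hprim₂ hprim₃ hinv₁ hinv₂ hinv₃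
    hN₂ hε hN₁D htrivD hN₃ hinvD₁ hinvD₃ hH2
  haveI := hfgS
  exact AnomalousTwistIndexPlumbing.lambdaInvariant_add_le_of_mid_anomalousTwist W p hp3 hV ha C hC K hK vbar hpvK hvbar hne κ hκ γ
    θsub θquot hpair hram Sf hSf DSsub DSquot c τ hreps₃ hmid htorS hμS hSsub hSquot

/-- **The same over the door's `3`-free `Sf` (the places over `N_W` off `3`), Greenberg-free** — generation 31's `AnomalousTwistLambdaLEOffP.…_offP` (x2's
off-`p` transfers `SplitMultSfTransfer`) on the theorem above. [cite: KellerYin2024, Thm. 1.4.1 (iii), §1.4 (arXiv:2402.12781v2)] [cite: MilneADT2006, I Thm. 4.10 (a)] -/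
theorem lambdaInvariant_add_le_of_anomalousTwist_offP {V : WeierstrassCurve ℚ} [V.IsElliptic] [V.IsGloballyMinimal]
    (hPT : ∀ (L : Type) [Field L] [NumberField L] [IsTotallyComplex L] (S : Set (HeightOneSpectrum (𝓞 L))),
      S.Finite → Literature.NumberTheory.GaloisCohomology.poitouTate_shaRestricted_tateDual_natural_at L S)
    (W : WeierstrassCurve ℚ) [W.IsElliptic] [W.IsGloballyMinimal] (p : ℕ) [Fact p.Prime]
    (hp3 : p = 3) (hV : GoodOrd V p) (ha : (p : ℤ) ∣ V.frobeniusTrace p - 1)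
    (C : VariableChange ℚ) (hC : C • V.quadraticTwist ((-1 : ℚ) ^ (p / 2) * p) = W) (haddv : Addv W p)
    (K : Type) [Field K] [NumberField K] (hK : IsImaginaryQuadratic K)
    (hCD2 : groupCdLE_two_galoisGroupUnramifiedOutside K)
    (hH : SatisfiesHeegnerHypothesis (W.conductorNorm ℤ) K)
    (htor : ∀ Q : (W.baseChange K).toAffine.Point, p • Q = 0 → Q = 0)
    (ι : K →+* ℚ_[p]) (v vbar : HeightOneSpectrum (𝓞 K))
    (hv : ∀ x : 𝓞 K, x ∈ v.asIdeal ↔ ‖ι (x : K)‖ < 1)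
    (hvbar : ((p : ℕ) : 𝓞 K) ∈ vbar.asIdeal) (hne : vbar ≠ v)
    (κ : ZpExtension K p) (hκ : κ.IsAnticyclotomic)
    (γ : absoluteGaloisGroup K) [Fact (κ.IsTopGenerator γ)]
    (θsub θquot : FramedGaloisRep K (padicCoeffIntegers (∅ : Set (PadicAlgCl p))) 1)
    (hpair : IsResidualPairOver (W.baseChange K) p θsub θquot)
    (hram : ∃ τ ∈ decomp vbar, unitChar θsub τ ≠ 1)
    (hfinED : Finite {x : ↥((W.baseChange K).geomPrimaryTorsion p) // ∀ g : ↥(κ.kerSubgroup ⊓ decomp vbar), g • x = x})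
    (Sf : Finset (HeightOneSpectrum (𝓞 K)))
    (hSf : ∀ w : HeightOneSpectrum (𝓞 K), w ∈ Sf ↔
      (((W.conductorNorm ℤ : ℤ) : 𝓞 K) ∈ w.asIdeal ∧ ((p : ℕ) : 𝓞 K) ∉ w.asIdeal))
    (DSsub : DatumDualData κ γ (charModule ∅ θsub)
        (AcSelmer.bdpData (charModule ∅ θsub) p vbar) (↑Sf : Set (HeightOneSpectrum (𝓞 K))))
    (DSquot : DatumDualData κ γ (charModule ∅ θquot)
        (AcSelmer.bdpData (charModule ∅ θquot) p vbar) (↑Sf : Set (HeightOneSpectrum (𝓞 K))))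
    (hfgS : Module.Finite (IwasawaAlgebra p) (AcSelmer.XAc (W.baseChange K) p κ vbar (↑Sf : Set (HeightOneSpectrum (𝓞 K))) γ))
    (htorS : Module.IsTorsion (IwasawaAlgebra p) (AcSelmer.XAc (W.baseChange K) p κ vbar (↑Sf : Set (HeightOneSpectrum (𝓞 K))) γ))
    (hμS : muInvariant p (AcSelmer.XAc (W.baseChange K) p κ vbar (↑Sf : Set (HeightOneSpectrum (𝓞 K))) γ) = 0)
    (hSsub : ∀ D : DatumDualData κ γ (charModule ∅ θsub)
        (AcSelmer.bdpData (charModule ∅ θsub) p vbar) (↑Sf : Set (HeightOneSpectrum (𝓞 K))),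
      Module.Finite (IwasawaAlgebra p) D.X ∧ Module.IsTorsion (IwasawaAlgebra p) D.X ∧ muInvariant p D.X = 0)
    (hSquot : ∀ D : DatumDualData κ γ (charModule ∅ θquot)
        (AcSelmer.bdpData (charModule ∅ θquot) p vbar) (↑Sf : Set (HeightOneSpectrum (𝓞 K))),
      Module.Finite (IwasawaAlgebra p) D.X ∧ Module.IsTorsion (IwasawaAlgebra p) D.X ∧ muInvariant p D.X = 0) :
    lambdaInvariant p DSsub.X + lambdaInvariant p DSquot.X ≤
      lambdaInvariant p (AcSelmer.XAc (W.baseChange K) p κ vbar (↑Sf : Set (HeightOneSpectrum (𝓞 K))) γ) +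
        (if ∀ σ : absoluteGaloisGroup K, θquot σ = 1 then 1 else 0) := by
  have hpv : ((p : ℕ) : 𝓞 K) ∈ v.asIdeal := IndexPlumbingNrVsStrict.natCast_mem_asIdeal_of_forall_norm_iff hv
  -- the x1-convention set `SN = Sf ∪ {v, v̄}` and its agreement with `Sf` off `p`
  set SN : Finset (HeightOneSpectrum (𝓞 K)) := insert v (insert vbar Sf) with hSNdef
  have hSp : ∀ w : HeightOneSpectrum (𝓞 K), ((p : ℕ) : 𝓞 K) ∈ w.asIdeal →
      w ∈ (↑(insert v (insert vbar Sf)) : Set (HeightOneSpectrum (𝓞 K))) :=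
    AcTwistDeformationResidualPair.mem_insert_insert_of_natCast_mem hK hpv hvbar hne Sf
  have hSN : ∀ w : HeightOneSpectrum (𝓞 K), w ∈ SN ↔ ((W.conductorNorm ℤ : ℤ) : 𝓞 K) ∈ w.asIdeal := by
    intro w
    constructor
    · intro hw
      rw [hSNdef, Finset.mem_insert, Finset.mem_insert] at hw
      rcases hw with rfl | rfl | hw
      · exact AnomalousTwistLambdaLEOffP.conductorNorm_mem_of_natCast_mem_of_addv W haddv hpv
      · exact AnomalousTwistLambdaLEOffP.conductorNorm_mem_of_natCast_mem_of_addv W haddv hvbar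
      · exact ((hSf w).mp hw).1
    · intro hN
      by_cases hpw : ((p : ℕ) : 𝓞 K) ∈ w.asIdeal
      · have h := hSp w hpw
        rw [Finset.mem_coe] at h
        rw [hSNdef]; exact h
      · rw [hSNdef, Finset.mem_insert, Finset.mem_insert]
        exact Or.inr (Or.inr ((hSf w).mpr ⟨hN, hpw⟩))
  have hoff : ∀ w : HeightOneSpectrum (𝓞 K), ((p : ℕ) : 𝓞 K) ∉ w.asIdeal →
      (w ∈ (↑Sf : Set (HeightOneSpectrum (𝓞 K))) ↔ w ∈ (↑SN : Set (HeightOneSpectrum (𝓞 K)))) := by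
    intro w hpw
    rw [Finset.mem_coe, Finset.mem_coe, hSNdef, Finset.mem_insert, Finset.mem_insert]
    constructor
    · exact fun hw ↦ Or.inr (Or.inr hw)
    · rintro (rfl | rfl | hw)
      · exact absurd hpv hpw
      · exact absurd hvbar hpw
      · exact hw
  have hoff' : ∀ w : HeightOneSpectrum (𝓞 K), ((p : ℕ) : 𝓞 K) ∉ w.asIdeal →
      (w ∈ (↑SN : Set (HeightOneSpectrum (𝓞 K))) ↔ w ∈ (↑Sf : Set (HeightOneSpectrum (𝓞 K)))) :=
    fun w hpw ↦ (hoff w hpw).symm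
  -- transfer of the curve-side invariants `Sf → SN`
  haveI hEK : (W.baseChange K).IsElliptic := inferInstanceAs (W.map (algebraMap ℚ K)).IsElliptic
  have hsel : AcSelmer.selmerAc (W.baseChange K) p κ vbar (↑Sf : Set (HeightOneSpectrum (𝓞 K))) =
      AcSelmer.selmerAc (W.baseChange K) p κ vbar (↑SN : Set (HeightOneSpectrum (𝓞 K))) :=
    selmerAc_congr_offP κ (W.baseChange K) vbar hoff
  obtain ⟨hfgT, htorT, hμT, hlamT⟩ := xAc_invariants_congr (W.baseChange K) p κ vbar γ hsel
  have hfgS' := hfgT hfgS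
  have htorS' := htorT htorS
  have hμS' : muInvariant p (AcSelmer.XAc (W.baseChange K) p κ vbar (↑SN : Set (HeightOneSpectrum (𝓞 K))) γ) = 0 := by
    rw [← hμT]; exact hμS
  -- transfer of the character-side `∀ D` clauses `Sf → SN`
  have hSsub' : ∀ D : DatumDualData κ γ (charModule ∅ θsub)
      (AcSelmer.bdpData (charModule ∅ θsub) p vbar) (↑SN : Set (HeightOneSpectrum (𝓞 K))),
      Module.Finite (IwasawaAlgebra p) D.X ∧ Module.IsTorsion (IwasawaAlgebra p) D.X ∧ muInvariant p D.X = 0 := fun D ↦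
    prop_datumDualData_congr_offP κ (AcSelmer.bdpData (charModule ∅ θsub) p vbar) hoff'
      (fun X _ _ ↦ Module.Finite (IwasawaAlgebra p) X ∧ Module.IsTorsion (IwasawaAlgebra p) X ∧ muInvariant p X = 0) hSsub D
  have hSquot' : ∀ D : DatumDualData κ γ (charModule ∅ θquot)
      (AcSelmer.bdpData (charModule ∅ θquot) p vbar) (↑SN : Set (HeightOneSpectrum (𝓞 K))),
      Module.Finite (IwasawaAlgebra p) D.X ∧ Module.IsTorsion (IwasawaAlgebra p) D.X ∧ muInvariant p D.X = 0 := fun D ↦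
    prop_datumDualData_congr_offP κ (AcSelmer.bdpData (charModule ∅ θquot) p vbar) hoff'
      (fun X _ _ ↦ Module.Finite (IwasawaAlgebra p) X ∧ Module.IsTorsion (IwasawaAlgebra p) X ∧ muInvariant p X = 0) hSquot D
  -- the `SN`-statement for every pair of `SN`-dual data
  have hmain : ∀ (D₁ : DatumDualData κ γ (charModule ∅ θsub)
        (AcSelmer.bdpData (charModule ∅ θsub) p vbar) (↑SN : Set (HeightOneSpectrum (𝓞 K))))
      (D₃ : DatumDualData κ γ (charModule ∅ θquot)
        (AcSelmer.bdpData (charModule ∅ θquot) p vbar) (↑SN : Set (HeightOneSpectrum (𝓞 K)))),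
      lambdaInvariant p D₁.X + lambdaInvariant p D₃.X ≤
        lambdaInvariant p (AcSelmer.XAc (W.baseChange K) p κ vbar (↑Sf : Set (HeightOneSpectrum (𝓞 K))) γ) +
          (if ∀ σ : absoluteGaloisGroup K, θquot σ = 1 then 1 else 0) := by
    intro D₁ D₃
    rw [hlamT]
    exact lambdaInvariant_add_le_of_anomalousTwist hPT W p hp3 hV ha C hC K hK hCD2 hH htor ι
      v vbar hv hvbar hne κ hκ γ θsub θquot hpair hram hfinED SN hSN D₁ D₃ hfgS' htorS' hμS' hSsub' hSquot'
  -- transfer of the conclusion `SN → Sf` (twice)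
  exact prop_datumDualData_congr_offP κ (AcSelmer.bdpData (charModule ∅ θsub) p vbar) hoff
    (fun X _ _ ↦ lambdaInvariant p X + lambdaInvariant p DSquot.X ≤
      lambdaInvariant p (AcSelmer.XAc (W.baseChange K) p κ vbar (↑Sf : Set (HeightOneSpectrum (𝓞 K))) γ) +
        (if ∀ σ : absoluteGaloisGroup K, θquot σ = 1 then 1 else 0))
    (fun D₁ ↦ prop_datumDualData_congr_offP κ (AcSelmer.bdpData (charModule ∅ θquot) p vbar) hoff
      (fun Y _ _ ↦ lambdaInvariant p D₁.X + lambdaInvariant p Y ≤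
        lambdaInvariant p (AcSelmer.XAc (W.baseChange K) p κ vbar (↑Sf : Set (HeightOneSpectrum (𝓞 K))) γ) +
          (if ∀ σ : absoluteGaloisGroup K, θquot σ = 1 then 1 else 0))
      (fun D₃ ↦ hmain D₁ D₃) DSquot) DSsub

end Summit.BirchSwinnertonDyer.BirchSwinnertonDyer.Theorems.SchneiderFreeAdditiveX3.AnomalousTwistLambdaLEOfPT

end
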